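import Literature.RingTheory.KTheory.MilnorKReal
import Literature.RingTheory.KTheory.MilnorKModTwo
import HarnessLib

/-!
# `k_nℝ ≅ ℤ/2ℤ`, generated by `l(−1)ⁿ` (Milnor, *Algebraic K-theory and quadratic forms*, Invent. Math. 9 (1970),
# §1 Example 1.6 read modulo 2, §4 Lemma 4.6)

Family `hodge`, lane `lit-hodgefound` (foundations library; seat `lit-hodgefound-p27`, generation 40, row g40-#11);
topic `RingTheory/KTheory`.  Sequel of `MilnorKReal` (g40-#5: EXAMPLE 1.6, `K_nℝ = ℤ·l(−1)ⁿ ⊕ posPart`,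
`zmultiples_sup_posPart_eq_top`, `posPart_divisible`, and for any ordered field the sign homomorphism
`signHomOrd F n : K_nF →+ ℤ/2` with `symbol_neg_one_ne_two_zsmul`) and `MilnorKModTwo` (g40-#9: `k_nF = K_nF/2K_nF`,
`kmk`, `kSymbol`, `kmk_zsmul_even`).  DEFINITIONS WITH BODIES (`kSignHom`, `kRealEquiv`) and PROVED THEOREMS; no
named fact, no instance, no notation, 0 `sorry`, net debt 0 (D-0026).

## The source, verbatim

J. Milnor, *Algebraic K-theory and quadratic forms*, Invent. Math. 9 (1970) 318–344 (held `paper:doi-10-1007-bf01425486`;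
bib key `Milnor1970`), §1 Example 1.6 (p0004 L13–L17): «Let ℝ be the field of real numbers. Then every K_nℝ, n ≥ 1,
splits as the direct sum of a cyclic group of order 2 generated by l(−1)ⁿ, and a divisible group generated by all
products l(a₁)⋯l(aₙ) with a₁, …, aₙ > 0»; and §4, proof of Lemma 4.6 (p0016 L21–L36): «Notice that this includes
the case of a finite, or local, or real closed, or quadratically closed field […] Futhermore, techniques similar to
those of §1.4 show that k_n is cyclic of order 2, generated by l(−1)ⁿ, for every n ≥ 2».

## What is formalised

* §1 for any ordered field `F`: `kSymbol_neg_one_ne_zero` (`l(−1)ⁿ ≠ 0` in `k_nF`, since `l(−1)ⁿ ∉ 2K_nF`) and the sign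
  character **`kSignHom F n : k_nF →+ ℤ/2`** induced by `signHomOrd` (it kills `2K_nF`), `kSignHom_kSymbol`,
  `kSignHom_kSymbol_neg_one = 1`.
* §2 for `ℝ`: **`exists_eq_zsmul_kSymbol_neg_one`** (the divisible part `posPart` dies modulo `2`, so every element of
  `k_nℝ` is a multiple of `l(−1)ⁿ`), **`eq_zero_or_eq_kSymbol_neg_one : k_nℝ = {0, l(−1)ⁿ}`**, and
  **`kRealEquiv m : Mod2 ℝ (m+1) ≃+ ZMod 2`**, the sign character, carrying `l(−1)^{m+1}` to `1` — «k_n is cyclic of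
  order 2, generated by l(−1)ⁿ».

## References

* [Milnor1970] J. Milnor, *Algebraic K-theory and quadratic forms*, Invent. Math. 9 (1970) 318–344 — §1 Example 1.6
  (p0004 L13–L17); §4, proof of Lemma 4.6 (p0016 L21–L36).

Provenance: lane `lit-hodgefound`, seat `lit-hodgefound-p27` gen 40 (agent `literature-prover-lit-hodgefound-p27-g40-0`),
row g40-#11.
-/

set_option autoImplicit false

noncomputable section

namespace Literature.RingTheory.KTheory

namespace MilnorK

open Function

section OrderedField

variable {F : Type*} [Field F] [LinearOrder F] [IsStrictOrderedRing F] {n : ℕ}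

/-- Over an ordered field, **`l(−1)ⁿ ≠ 0` in `k_nF`** («l(−1)ⁿ is not divisible»: it is not in `2K_nF`). [cite: Milnor1970, §1 proof of Theorem 1.4, the sign homomorphism K_nF → ℤ/2ℤ (p0003 L24–L43); Example 1.6 «l(−1)ⁿ is not divisible» (p0004 L16–L17)] -/
theorem kSymbol_neg_one_ne_zero : kSymbol (fun _ : Fin n => (-1 : Fˣ)) ≠ 0 := by
  intro h
  rw [kSymbol, kmk_eq_zero_iff] at h
  obtain ⟨y, hy⟩ := h
  exact symbol_neg_one_ne_two_zsmul y hy.symm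

variable (F n) in
/-- **The sign character `k_nF → ℤ/2ℤ` of an ordered field**: the homomorphism `l(a₁)⋯l(aₙ) ↦ ∏ (1 − sgn aᵢ)/2` of the
proof of Theorem 1.4 kills `2K_nF`, hence factors through `k_nF = K_nF/2K_nF`. [cite: Milnor1970, §1 proof of Theorem 1.4, the sign homomorphism K_nF → ℤ/2ℤ (p0003 L24–L43); Example 1.6 «l(−1)ⁿ is not divisible» (p0004 L16–L17)] -/
def kSignHom : Mod2 F n →+ ZMod 2 :=
  QuotientAddGroup.lift (twoMultiples F n) (signHomOrd F n) (by
    rintro x ⟨z, rfl⟩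
    rw [AddMonoidHom.mem_ker, zsmulAddGroupHom_apply]
    exact signHomOrd_two_zsmul z)

/-- `kSignHom` on classes is `signHomOrd`. [cite: Milnor1970, §1 proof of Theorem 1.4, the sign homomorphism K_nF → ℤ/2ℤ (p0003 L24–L43); Example 1.6 «l(−1)ⁿ is not divisible» (p0004 L16–L17)] -/
theorem kSignHom_kmk (x : MilnorK F n) : kSignHom F n (kmk F n x) = signHomOrd F n x :=
  QuotientAddGroup.lift_mk _ _ x

/-- `kSignHom {a₁, …, aₙ} = ∏ (1 − sgn aᵢ)/2`. [cite: Milnor1970, §1 proof of Theorem 1.4, the sign homomorphism K_nF → ℤ/2ℤ (p0003 L24–L43); Example 1.6 «l(−1)ⁿ is not divisible» (p0004 L16–L17)] -/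
theorem kSignHom_kSymbol (a : Fin n → Fˣ) : kSignHom F n (kSymbol a) = ∏ j, sgnBit (nonnegPreordering F) (a j) := by
  rw [kSymbol, kSignHom_kmk, signHomOrd_symbol]

/-- «which carries l(−1)ⁿ to 1». [cite: Milnor1970, §1 proof of Theorem 1.4, the sign homomorphism K_nF → ℤ/2ℤ (p0003 L24–L43); Example 1.6 «l(−1)ⁿ is not divisible» (p0004 L16–L17)] -/
theorem kSignHom_kSymbol_neg_one : kSignHom F n (kSymbol fun _ : Fin n => (-1 : Fˣ)) = 1 := by
  rw [kSymbol, kSignHom_kmk, signHomOrd_symbol_neg_one]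

end OrderedField

/-! ### `k_nℝ ≅ ℤ/2ℤ` -/

section Real

/-- **Every element of `k_nℝ`, `n ≥ 1`, is a multiple of `l(−1)ⁿ`**: by EXAMPLE 1.6, `K_nℝ = ℤ·l(−1)ⁿ + posPart` with
`posPart` divisible, hence `posPart ⊆ 2K_nℝ` dies in `k_nℝ`. [cite: Milnor1970, §1 Example 1.6 (p0004 L13–L17); §4 proof of Lemma 4.6 «k_n is cyclic of order 2, generated by l(−1)ⁿ» (p0016 L35–L36)] -/
theorem exists_eq_zsmul_kSymbol_neg_one (m : ℕ) (x : Mod2 ℝ (m + 1)) :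
    ∃ c : ℤ, x = c • kSymbol (fun _ : Fin (m + 1) => (-1 : ℝˣ)) := by
  obtain ⟨z, rfl⟩ := kmk_surjective x
  have hz : z ∈ AddSubgroup.zmultiples (symbol (fun _ : Fin (m + 1) => (-1 : ℝˣ))) ⊔ posPart (m + 1) := by
    rw [zmultiples_sup_posPart_eq_top]; trivial
  obtain ⟨u, hu, p, hp, rfl⟩ := AddSubgroup.mem_sup.1 hz
  obtain ⟨c, rfl⟩ := AddSubgroup.mem_zmultiples_iff.1 hu
  obtain ⟨w, -, hw⟩ := posPart_divisible m hp two_ne_zero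
  refine ⟨c, ?_⟩
  rw [map_add, ← hw, Nat.cast_ofNat, kmk_two_zsmul, add_zero, map_zsmul, kSymbol_def]

/-- **`k_nℝ = {0, l(−1)ⁿ}`** for `n ≥ 1`. [cite: Milnor1970, §1 Example 1.6 (p0004 L13–L17); §4 proof of Lemma 4.6 «k_n is cyclic of order 2, generated by l(−1)ⁿ» (p0016 L35–L36)] -/
theorem eq_zero_or_eq_kSymbol_neg_one (m : ℕ) (x : Mod2 ℝ (m + 1)) :
    x = 0 ∨ x = kSymbol (fun _ : Fin (m + 1) => (-1 : ℝˣ)) := by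
  obtain ⟨c, rfl⟩ := exists_eq_zsmul_kSymbol_neg_one m x
  rcases Int.even_or_odd c with hc | hc
  · left
    rw [kSymbol_def, ← map_zsmul]
    exact kmk_zsmul_even hc _
  · right
    obtain ⟨j, rfl⟩ := hc
    rw [add_zsmul, one_zsmul, kSymbol_def, ← map_zsmul, kmk_zsmul_even (even_two_mul j), zero_add]

/-- The sign character of `k_nℝ`, `n ≥ 1`, is injective. [cite: Milnor1970, §1 Example 1.6 (p0004 L13–L17); §4 proof of Lemma 4.6 «k_n is cyclic of order 2, generated by l(−1)ⁿ» (p0016 L35–L36)] -/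
theorem kSignHom_injective (m : ℕ) : Function.Injective (kSignHom ℝ (m + 1)) := by
  intro x y hxy
  rcases eq_zero_or_eq_kSymbol_neg_one m x with rfl | rfl <;>
    rcases eq_zero_or_eq_kSymbol_neg_one m y with rfl | rfl
  · rfl
  · rw [map_zero, kSignHom_kSymbol_neg_one] at hxy; exact absurd hxy zero_ne_one
  · rw [map_zero, kSignHom_kSymbol_neg_one] at hxy; exact absurd hxy one_ne_zero
  · rfl

/-- The sign character of `k_nℝ`, `n ≥ 1`, is surjective (`l(−1)ⁿ ↦ 1`). [cite: Milnor1970, §1 Example 1.6 (p0004 L13–L17); §4 proof of Lemma 4.6 «k_n is cyclic of order 2, generated by l(−1)ⁿ» (p0016 L35–L36)] -/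
theorem kSignHom_surjective (m : ℕ) : Function.Surjective (kSignHom ℝ (m + 1)) := by
  intro t
  fin_cases t
  · exact ⟨0, map_zero _⟩
  · exact ⟨_, kSignHom_kSymbol_neg_one⟩

/-- **`k_nℝ ≅ ℤ/2ℤ` for `n ≥ 1`**, «cyclic of order 2, generated by l(−1)ⁿ» — the sign character as an isomorphism. [cite: Milnor1970, §1 Example 1.6 (p0004 L13–L17); §4 proof of Lemma 4.6 «k_n is cyclic of order 2, generated by l(−1)ⁿ» (p0016 L35–L36)] -/
def kRealEquiv (m : ℕ) : Mod2 ℝ (m + 1) ≃+ ZMod 2 :=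
  AddEquiv.ofBijective (kSignHom ℝ (m + 1)) ⟨kSignHom_injective m, kSignHom_surjective m⟩

/-- `kRealEquiv` carries the generator `l(−1)ⁿ` to `1`. [cite: Milnor1970, §1 Example 1.6 (p0004 L13–L17); §4 proof of Lemma 4.6 «k_n is cyclic of order 2, generated by l(−1)ⁿ» (p0016 L35–L36)] -/
theorem kRealEquiv_kSymbol_neg_one (m : ℕ) : kRealEquiv m (kSymbol fun _ : Fin (m + 1) => (-1 : ℝˣ)) = 1 :=
  kSignHom_kSymbol_neg_one

/-- `kRealEquiv {a₁, …, aₙ} = ∏ (1 − sgn aᵢ)/2`: a symbol is `l(−1)ⁿ` in `k_nℝ` iff all its entries are negative, else `0`.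
[cite: Milnor1970, §1 Example 1.6 (p0004 L13–L17); §4 proof of Lemma 4.6 «k_n is cyclic of order 2, generated by l(−1)ⁿ» (p0016 L35–L36)] -/
theorem kRealEquiv_kSymbol (m : ℕ) (a : Fin (m + 1) → ℝˣ) :
    kRealEquiv m (kSymbol a) = ∏ j, sgnBit (nonnegPreordering ℝ) (a j) :=
  kSignHom_kSymbol a

end Real

end MilnorK

end Literature.RingTheory.KTheory

end
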